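import Summits.ValiantsHypothesis.ValiantsHypothesis.Theorems.LacunarySymmetroidMatrixDescartesOverlapWindowCoeff

/-!
# `MatrixDescartes` — a rank-one letter's window sees the null compression (m = 2): the identity behind the flag count

HONEST FRAMING.  Object-search cell `pub-symmetroid`, crux `Theses.LacunarySymmetroid.MatrixDescartes` (ledger item
`stmt-ValiantsHypothesis-18050`, route `LacunarySymmetroid`; seat `val-sym-mdr-p2`, gen 13).  The crux implies `VP ≠ VNP`
by the route's assembly; NOTHING here is progress on it, and nothing here is a claim about `VP ≠ VNP`, `DoorA26` /
`DoorA34` or the cell's registers.  Sequel of `…OverlapWindowCoeff` (robust Descartes rule in coefficient currency).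

LOCATED MOTIVATION (seat folder `exp/live_profile.py`, memo OVERLAP-LAW §4b): on the census extremals from `K = 5` on, two
thirds to three quarters of the roots sit under a SINGLE norm-dominant but near-singular letter (the grafted / flag ends), the
maximal norm-live width staying `3–4 < K`.  There the pure power `det S t·X^(2 d t)` of the overlap window law is dead and the
count must be read from the true coefficients.  For `m = 2` this is explicit (`det_pencil_eq_of_rankOne`): if
`S t = a·w wᵀ` has rank one, then
  `det F = det F_¬t + a·X^(d t)·q_t(X)`,  `q_t(X) = ∑_{l ≠ t} (w⊥ᵀ S l w⊥)·X^(d l)`,  `w⊥ = (w₁, −w₀)`,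
(`det_add_smul_vecMulVec_two`: `det(c·wwᵀ + G) = det G + c·w⊥ᵀ G w⊥` for 2×2 matrices over any commutative ring — the
adjugate of `wwᵀ` is `w⊥w⊥ᵀ`), i.e. the window of the rank-one letter sees EXACTLY the null compression `q_t` of the other
letters — the `(#letters − 1)`-nomial whose external sign changes are the `γ` of the cell's γ-ladder
(`ζ(2,K+1) ≥ ζ(2,K) + 2 + γ`, CONJECTURE §2.1c).  RECIPE (upper side): in a window where `a·x^(d t)·‖w‖²` dominates the other
letters in norm, apply `Overlap.card_roots_Icc_le_coeff` / `…_coeff_two` to `det F` with the cuts at the exponents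
`d t + d l` of `q_t` other than the survivor(s): the coefficients of `det F_¬t` are second-order small there, so the window
carries at most `#supp q_t − 1 ≤ K − 2` zeros (`K − 3` + parity with two survivors) — the Descartes count of the compression,
matching `γ_max(K−1) ≤ K − 2` read from above (attained at `K − 1 = 3, 4`: `γ_max = 2, 3`, CONJECTURE §3 A-thin).  No new
`def`; `Matrix.det_fin_two`.  [folklore]
-/

-- `Summit.ValiantsHypothesis.ValiantsHypothesis.…` repeats a component by the D-0017 layout (single-conjunct summit).
set_option linter.dupNamespace false

namespace Summit.ValiantsHypothesis.ValiantsHypothesis.Theorems.LacunarySymmetroidMatrixDescartes.Overlap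

open Polynomial Finset Set
open scoped BigOperators Matrix

variable {K : ℕ}

/-! ## §16 `det(c·wwᵀ + G) = det G + c·w⊥ᵀ G w⊥` for 2 × 2 matrices -/

/-- **Rank-one update of a 2×2 determinant.**  Over any commutative ring, `det(c·w wᵀ + G) = det G + c·(w⊥ᵀ G w⊥)` with
`w⊥ = (w 1, −w 0)`, written out: `c·(w 1·w 1·G 0 0 − w 0·w 1·(G 0 1 + G 1 0) + w 0·w 0·G 1 1)`.  (The `c²` term is
`det(wwᵀ) = 0`; the mixed term is `tr(adj(wwᵀ)·G)` and `adj(wwᵀ) = w⊥w⊥ᵀ`.) [folklore] -/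
theorem det_add_smul_vecMulVec_two {R : Type*} [CommRing R] (c : R) (w : Fin 2 → R) (G : Matrix (Fin 2) (Fin 2) R) :
    Matrix.det (c • Matrix.vecMulVec w w + G) =
      Matrix.det G + c * (w 1 * w 1 * G 0 0 - w 0 * w 1 * (G 0 1 + G 1 0) + w 0 * w 0 * G 1 1) := by
  rw [Matrix.det_fin_two, Matrix.det_fin_two]
  simp only [Matrix.add_apply, Matrix.smul_apply, Matrix.vecMulVec_apply, smul_eq_mul]
  ring

/-! ## §17 The pencil with a rank-one letter: `det F = det F_¬t + a·X^(d t)·(null compression)` -/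

/-- **A rank-one letter's window sees the null compression.**  For a real 2×2 lacunary pencil `F = ∑ₗ X^(d l) • S l` whose
letter `t` is `S t = a·w wᵀ`, the determinant splits as
`det F = det(∑_{l ≠ t} X^(d l) • S l) + C a · X^(d t) · ∑_{l ≠ t} C(w⊥ᵀ S l w⊥) · X^(d l)` with
`w⊥ᵀ S w⊥ = w 1·w 1·S 0 0 − w 0·w 1·(S 0 1 + S 1 0) + w 0·w 0·S 1 1`.  The second factor is the NULL COMPRESSION of the other
letters — a `(K−1)`-nomial; its external sign changes are the `γ` of the γ-ladder. [folklore] -/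
theorem det_pencil_eq_of_rankOne (d : Fin K → ℕ) (S : Fin K → Matrix (Fin 2) (Fin 2) ℝ) (t : Fin K) (a : ℝ)
    (w : Fin 2 → ℝ) (ht : S t = a • Matrix.vecMulVec w w) :
    Matrix.det (∑ l, ((X : ℝ[X]) ^ d l) • (S l).map C) =
      Matrix.det (∑ l ∈ Finset.univ.erase t, ((X : ℝ[X]) ^ d l) • (S l).map C) +
        C a * X ^ (d t) * ∑ l ∈ Finset.univ.erase t,
          C (w 1 * w 1 * S l 0 0 - w 0 * w 1 * (S l 0 1 + S l 1 0) + w 0 * w 0 * S l 1 1) * X ^ (d l) := by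
  classical
  set G : Matrix (Fin 2) (Fin 2) ℝ[X] := ∑ l ∈ Finset.univ.erase t, ((X : ℝ[X]) ^ d l) • (S l).map C with hG
  have hsplit : (∑ l, ((X : ℝ[X]) ^ d l) • (S l).map C) =
      (X ^ (d t) * C a) • Matrix.vecMulVec (fun i => C (w i)) (fun i => C (w i)) + G := by
    rw [← Finset.add_sum_erase _ _ (Finset.mem_univ t), hG]
    congr 1
    rw [ht]
    ext i j
    simp only [Matrix.smul_apply, Matrix.map_apply, Matrix.vecMulVec_apply, smul_eq_mul, C_mul]
    ring
  rw [hsplit, det_add_smul_vecMulVec_two]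
  congr 1
  -- the compression of `G` along `w⊥`
  have hG00 : G 0 0 = ∑ l ∈ Finset.univ.erase t, X ^ (d l) * C (S l 0 0) := by
    rw [hG]; simp [Matrix.sum_apply, Matrix.smul_apply, smul_eq_mul]
  have hG01 : G 0 1 = ∑ l ∈ Finset.univ.erase t, X ^ (d l) * C (S l 0 1) := by
    rw [hG]; simp [Matrix.sum_apply, Matrix.smul_apply, smul_eq_mul]
  have hG10 : G 1 0 = ∑ l ∈ Finset.univ.erase t, X ^ (d l) * C (S l 1 0) := by
    rw [hG]; simp [Matrix.sum_apply, Matrix.smul_apply, smul_eq_mul]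
  have hG11 : G 1 1 = ∑ l ∈ Finset.univ.erase t, X ^ (d l) * C (S l 1 1) := by
    rw [hG]; simp [Matrix.sum_apply, Matrix.smul_apply, smul_eq_mul]
  rw [hG00, hG01, hG10, hG11, ← Finset.sum_add_distrib, Finset.mul_sum, Finset.mul_sum, Finset.mul_sum, Finset.mul_sum,
    ← Finset.sum_sub_distrib, ← Finset.sum_add_distrib, Finset.mul_sum]
  refine Finset.sum_congr rfl fun l _ => ?_
  simp only [map_sub, map_add, map_mul]
  ring

/-- **The compression coefficient.**  With injective exponents, the coefficient of `det F` at `d t + d l` (`l ≠ t`) is the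
coefficient of `det F_¬t` there plus `a·(w⊥ᵀ S l w⊥)` — the survivor coefficient of the rank-one letter's window in the
coefficient-currency law (the `det F_¬t` part is second-order small where `t` dominates in norm). [folklore] -/
theorem coeff_det_pencil_of_rankOne (d : Fin K → ℕ) (hd : Function.Injective d) (S : Fin K → Matrix (Fin 2) (Fin 2) ℝ)
    (t : Fin K) (a : ℝ) (w : Fin 2 → ℝ) (ht : S t = a • Matrix.vecMulVec w w) (l : Fin K) (hl : l ≠ t) :
    (Matrix.det (∑ l, ((X : ℝ[X]) ^ d l) • (S l).map C)).coeff (d t + d l) =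
      (Matrix.det (∑ l ∈ Finset.univ.erase t, ((X : ℝ[X]) ^ d l) • (S l).map C)).coeff (d t + d l) +
        a * (w 1 * w 1 * S l 0 0 - w 0 * w 1 * (S l 0 1 + S l 1 0) + w 0 * w 0 * S l 1 1) := by
  classical
  rw [det_pencil_eq_of_rankOne d S t a w ht, coeff_add]
  congr 1
  rw [mul_assoc, coeff_C_mul, Finset.mul_sum, finsetSum_coeff]
  have hterm : ∀ l' ∈ Finset.univ.erase t,
      (X ^ d t * (C (w 1 * w 1 * S l' 0 0 - w 0 * w 1 * (S l' 0 1 + S l' 1 0) + w 0 * w 0 * S l' 1 1) * X ^ (d l'))).coeff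
        (d t + d l) = if l' = l then (w 1 * w 1 * S l 0 0 - w 0 * w 1 * (S l 0 1 + S l 1 0) + w 0 * w 0 * S l 1 1) else 0 := by
    intro l' _
    rw [mul_left_comm, ← pow_add, coeff_C_mul_X_pow]
    by_cases h : l' = l
    · subst h; simp
    · have hne : d t + d l ≠ d t + d l' := fun heq => h (hd (by omega)).symm
      rw [if_neg hne, if_neg h]
  rw [Finset.sum_congr rfl hterm, Finset.sum_ite_eq' (Finset.univ.erase t) l, if_pos (Finset.mem_erase.2 ⟨hl, Finset.mem_univ l⟩)]

end Summit.ValiantsHypothesis.ValiantsHypothesis.Theorems.LacunarySymmetroidMatrixDescartes.Overlap
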